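import Mathlib.Data.Finset.Card
import Mathlib.Tactic.Ring
import Mathlib.Tactic.NormNum
import Mathlib.Tactic.FinCases
import Literature.Computability.Complexity.Circuit
import Literature.Computability.Complexity.CircuitComposition
import Literature.Computability.Complexity.NegationLimited
import HarnessLib

/-!
# Negation elimination (Jukna 2012, Exercise 9.7) and constant elimination

Infrastructure for negation-limited circuit lower bounds (route PneNP/NegLimited; the
Amano–Maruoka fact `Literature.Computability.Complexity.amano_maruoka`), over the straight-line circuits of
`Literature.Computability.Complexity.Circuit` and the gate-list calculus (`GateList.vals`,
`GateList.WF`, `GateList.wireOf`) of `Literature.Computability.Complexity.CircuitComposition`.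
Everything in this file is PROVED (no named facts).

* `TwoSidedApprox r A B g` — Jukna's separation predicate behind *`r`-hard pairs* (§9.9):
  `g` rejects a `2⁻ʳ` fraction of `A` and accepts a `2⁻ʳ` fraction of `B`, or the other way
  round (denominators cleared). API: `mono`, `congr`, `of_forall`, `of_filter`, `of_half`,
  `not_of_forall_eq`.
* Straight-line surgery: `GateList.vals_append`, `getD_vals_append_cons` (value of a middle
  gate), `vals_replace_eq` / `WF.replace` (replacing one gate), `negs` (NOT count of a list,
  `= Circuit.negationCount`), `exists_first_notGate`.
* `GateList.constElim`, `GateList.const_or_exists_monotone_circuit` — **constant elimination**: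
  a program over `{∧₂, ∨₂, 0, 1}` has a companion program over `{∧₂, ∨₂}`, no longer, carrying
  every non-constant wire (the tree's `monotoneBasis` has no constants).
* `Circuit.monotone_eval_of_isOver_monotoneBasis` — circuits over `{∧₂, ∨₂}` compute monotone
  functions.
* `negationElimination` (`def … : Prop`, Jukna 2012, Ex. 9.7) and its proof
  `negationElimination_holds`: a circuit over `{∧₂, ∨₂, ¬}` with `≤ r` NOT gates rejecting `A`
  and accepting `B` yields `g`, constant or computed over `{∧₂, ∨₂}` with no more gates, with
  `TwoSidedApprox r A B g`. Proof as in Jukna's hint: induction on `r`; the first NOT gate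
  reads a monotone sub-program `g₀`; with `ε` the majority value of `g₀` on `A`, either `g₀`
  already `2⁻¹`-separates (done), or on the halves of `A` and `B` where `g₀ = ε` the NOT gate is
  the constant `¬ε`, so it is *frozen* to a constant gate (one NOT gate fewer, same values on
  the surviving inputs) and the induction hypothesis applies; finally constants are eliminated.
* `Circuit.lt_size_of_hardPair` — the finite lower-bound form (Jukna 2012, §9.9): if no
  `{∧₂, ∨₂}`-circuit with `≤ t` gates `2⁻ʳ`-separates a nonempty pair `(A, B)`, every
  `{∧₂, ∨₂, ¬}`-circuit with `≤ r` NOT gates separating `A` from `B` has `> t` gates.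

Design: the intermediate bases `deMorganBasis01 = {∧₂, ∨₂, ¬, 0, 1}` and
`monotoneBasis01 = {∧₂, ∨₂, 0, 1}` (constant gates `GateFn.const`) are where frozen NOT gates
live; statements exported for users mention only `deMorganBasis` / `monotoneBasis`.

## References

* S. Jukna, *Boolean Function Complexity: Advances and Frontiers*, Springer (2012), §9.9
  (pp. 273–274, `r`-hard pairs), Exercise 9.7 (p. 283), §10.5 (p. 296) [Jukna2012].
* K. Amano, A. Maruoka, *A superpolynomial lower bound for a circuit computing the clique
  function with at most (1/6) log log n negation gates*, SIAM J. Comput. 35 (2005) 201–216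
  [AmanoMaruoka2005] (the application; see `AmanoMaruoka.lean`).
-/

namespace Literature.Computability.Complexity

open Finset GateList

variable {ι : Type*}

/-! ### Bases with constants -/

/-- The De Morgan basis with the two constant gates adjoined, `{∧₂, ∨₂, ¬, 0, 1}`; constants
appear when a NOT gate is frozen on a set of inputs where its argument is constant
(Jukna 2012, §1.2 and Ex. 9.7). [cite: Jukna2012, §1.2] -/
def deMorganBasis01 : Set GateFn :=
  insert (GateFn.const true) (insert (GateFn.const false) deMorganBasis)

/-- The monotone basis with the two constant gates adjoined, `{∧₂, ∨₂, 0, 1}` (Jukna 2012,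
§9.10: monotone circuits start from the variables and the two constants).
[cite: Jukna2012, §9.10] -/
def monotoneBasis01 : Set GateFn :=
  insert (GateFn.const true) (insert (GateFn.const false) monotoneBasis)

/-- `{∧₂, ∨₂, ¬} ⊆ {∧₂, ∨₂, ¬, 0, 1}`. [folklore] -/
theorem deMorganBasis_subset_deMorganBasis01 : deMorganBasis ⊆ deMorganBasis01 :=
  fun _ h => Set.mem_insert_of_mem _ (Set.mem_insert_of_mem _ h)

/-- `{∧₂, ∨₂} ⊆ {∧₂, ∨₂, 0, 1}`. [folklore] -/
theorem monotoneBasis_subset_monotoneBasis01 : monotoneBasis ⊆ monotoneBasis01 :=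
  fun _ h => Set.mem_insert_of_mem _ (Set.mem_insert_of_mem _ h)

/-- The constant gates are in `{∧₂, ∨₂, ¬, 0, 1}`. [folklore] -/
theorem const_mem_deMorganBasis01 (b : Bool) : GateFn.const b ∈ deMorganBasis01 := by
  cases b
  · exact Set.mem_insert_of_mem _ (Set.mem_insert _ _)
  · exact Set.mem_insert _ _

/-- A constant gate is not the NOT gate (arities `0 ≠ 1`). [folklore] -/
theorem GateFn.const_ne_not (b : Bool) : GateFn.const b ≠ GateFn.not := fun h => by
  have := congrArg Sigma.fst h
  simp [GateFn.const, GateFn.not] at this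

/-- `negWeight (const b) = 0`. [folklore] -/
@[simp] theorem negWeight_const (b : Bool) : negWeight (GateFn.const b) = 0 := by
  simp [negWeight, GateFn.const_ne_not]

/-- `negWeight g = 0` unless `g` is the NOT gate. [folklore] -/
theorem negWeight_eq_one_iff (g : GateFn) : negWeight g = 1 ↔ g = GateFn.not := by
  unfold negWeight; split <;> simp_all

/-- A gate of `{∧₂, ∨₂, ¬, 0, 1}` other than NOT is a gate of `{∧₂, ∨₂, 0, 1}`. [folklore] -/
theorem mem_monotoneBasis01_of_ne_not {g : GateFn} (h : g ∈ deMorganBasis01) (hn : g ≠ GateFn.not) :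
    g ∈ monotoneBasis01 := by
  simp only [deMorganBasis01, deMorganBasis, Set.mem_insert_iff, Set.mem_singleton_iff] at h
  simp only [monotoneBasis01, monotoneBasis, Set.mem_insert_iff, Set.mem_singleton_iff]
  tauto

namespace GateList

/-! ### Straight-line surgery -/

/-- One evaluation step of a straight-line program on input `x`: append the value of the next
gate (Arora–Barak 2009, Rem. 6.4). [folklore] -/
def step (x : ι → Bool) (vs : List Bool) (g : Gate ι) : List Bool :=
  vs ++ [g.op fun a => wireOf x vs (g.args a)]

/-- Evaluating `pre ++ post` evaluates `post` on top of the values of `pre`. [folklore] -/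
theorem vals_append (pre post : List (Gate ι)) (x : ι → Bool) :
    vals (pre ++ post) x = post.foldl (step x) (vals pre x) := by
  unfold vals
  rw [List.foldl_append]
  rfl

/-- Folding further gates only appends values. [folklore] -/
theorem foldl_step_prefix (post : List (Gate ι)) (x : ι → Bool) (init : List Bool) :
    ∃ ws, post.foldl (step x) init = init ++ ws := by
  induction post generalizing init with
  | nil => exact ⟨[], by simp⟩
  | cons g post ih =>
    obtain ⟨ws, hws⟩ := ih (step x init g)
    exact ⟨[g.op fun a => wireOf x init (g.args a)] ++ ws,
      by rw [List.foldl_cons, hws, step, List.append_assoc]⟩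

/-- Values already computed are unchanged by folding further gates. [folklore] -/
theorem getD_foldl_step_of_lt (post : List (Gate ι)) (x : ι → Bool) (init : List Bool) {m : ℕ}
    (hm : m < init.length) : (post.foldl (step x) init).getD m false = init.getD m false := by
  obtain ⟨ws, h⟩ := foldl_step_prefix post x init
  rw [h, List.getD_eq_getElem?_getD, List.getD_eq_getElem?_getD, List.getElem?_append_left hm]

/-- The value of the gate at position `pre.length` of `pre ++ g :: post`. [folklore] -/
theorem getD_vals_append_cons (pre : List (Gate ι)) (g : Gate ι) (post : List (Gate ι))
    (x : ι → Bool) :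
    (vals (pre ++ g :: post) x).getD pre.length false =
      g.op (fun a => wireOf x (vals pre x) (g.args a)) := by
  rw [vals_append, List.foldl_cons, getD_foldl_step_of_lt _ _ _ (by simp [step])]
  simp [step, List.getD_eq_getElem?_getD]

/-- Wires into `pre` keep their value in `pre ++ post`. [folklore] -/
theorem wireOf_vals_append (pre post : List (Gate ι)) (x : ι → Bool) (w : ι ⊕ ℕ)
    (hw : ∀ m, w = .inr m → m < pre.length) :
    wireOf x (vals (pre ++ post) x) w = wireOf x (vals pre x) w := by
  obtain ⟨ws, h⟩ := vals_append_take pre post x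
  rw [h]
  exact wireOf_append_of_lt x _ _ w (by simpa using hw)

/-- Replacing one gate by a gate with the same value on input `x` does not change any gate
value on `x`. [folklore] -/
theorem vals_replace_eq (pre post : List (Gate ι)) (g g' : Gate ι) (x : ι → Bool)
    (h : g.op (fun a => wireOf x (vals pre x) (g.args a)) =
      g'.op (fun a => wireOf x (vals pre x) (g'.args a))) :
    vals (pre ++ g :: post) x = vals (pre ++ g' :: post) x := by
  rw [vals_append, vals_append, List.foldl_cons, List.foldl_cons, step, step, h]

/-- Replacing one gate by a gate valid at that position keeps the program well formed.
[folklore] -/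
theorem WF.replace {pre post : List (Gate ι)} {g g' : Gate ι} (h : WF (pre ++ g :: post))
    (hg' : GateOK pre.length g') : WF (pre ++ g' :: post) := by
  intro j g₀ hj
  rcases lt_trichotomy j pre.length with hlt | rfl | hgt
  · refine h j g₀ ?_
    rw [List.getElem?_append_left hlt] at hj ⊢
    exact hj
  · rw [List.getElem?_append_right le_rfl, Nat.sub_self, List.getElem?_cons_zero] at hj
    cases hj
    exact hg'
  · refine h j g₀ ?_
    rw [List.getElem?_append_right hgt.le] at hj ⊢
    obtain ⟨k, hk⟩ : ∃ k, j - pre.length = k + 1 := ⟨j - pre.length - 1, by omega⟩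
    rw [hk, List.getElem?_cons_succ] at hj ⊢
    exact hj

/-- In a well-formed program `pre ++ g :: post`, the gate `g` only reads `pre`. [folklore] -/
theorem WF.gateOK_mid {pre post : List (Gate ι)} {g : Gate ι} (h : WF (pre ++ g :: post)) :
    GateOK pre.length g :=
  h _ _ (by simp)

/-- The number of NOT gates of a gate list (`Circuit.negationCount` for bare lists).
[Jukna 2012, §10.1] [folklore] -/
noncomputable def negs (gs : List (Gate ι)) : ℕ := (gs.map fun g => negWeight g.fn).sum

/-- `negs` is additive. [folklore] -/
@[simp] theorem negs_append (l l' : List (Gate ι)) : negs (l ++ l') = negs l + negs l' := by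
  simp [negs]

/-- `negs` of a cons. [folklore] -/
@[simp] theorem negs_cons (g : Gate ι) (l : List (Gate ι)) :
    negs (g :: l) = negWeight g.fn + negs l := by
  simp [negs]

/-- `negs [] = 0`. [folklore] -/
@[simp] theorem negs_nil : negs ([] : List (Gate ι)) = 0 := by simp [negs]

/-- `Circuit.negationCount` is `negs` of the gate list (definitional). [folklore] -/
theorem circuit_negationCount (C : Circuit ι) : C.negationCount = negs C.gates := rfl

/-- A gate list with a NOT gate somewhere has one at some position. [folklore] -/
theorem exists_fn_eq_not_of_negs_ne_zero :
    ∀ {gs : List (Gate ι)}, negs gs ≠ 0 → ∃ i, ∃ h : i < gs.length, (gs[i]).fn = GateFn.not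
  | [], h => by simp at h
  | g :: gs, h => by
    by_cases hg : g.fn = GateFn.not
    · exact ⟨0, by simp, hg⟩
    · have h0 : negWeight g.fn = 0 := by simp [negWeight, hg]
      rw [negs_cons, h0, zero_add] at h
      obtain ⟨i, hi, hfn⟩ := exists_fn_eq_not_of_negs_ne_zero h
      exact ⟨i + 1, by simpa using hi, by simpa using hfn⟩

/-- A gate with gate function `G` is `G` wired somehow. [folklore] -/
theorem _root_.Literature.Computability.Complexity.Gate.exists_eq_of_fn_eq {g : Gate ι} {G : GateFn} (h : g.fn = G) :
    ∃ args : Fin G.1 → ι ⊕ ℕ, g = ⟨G.1, G.2, args⟩ := by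
  obtain ⟨k, op, args⟩ := g
  subst h
  exact ⟨args, rfl⟩

/-- The constant gate `b` as a (wireless) gate of a straight-line program. [folklore] -/
def constGate (ι : Type*) (b : Bool) : Gate ι := ⟨0, fun _ => b, Fin.elim0⟩

/-- Its gate function is `GateFn.const b`. [folklore] -/
@[simp] theorem constGate_fn (b : Bool) : (constGate ι b).fn = GateFn.const b := rfl

/-- A wireless gate is valid at every position. [folklore] -/
theorem gateOK_constGate (n : ℕ) (b : Bool) : GateOK n (constGate ι b) := fun a => a.elim0

/-- The evaluation of a circuit is the value of its output wire (definitional). [folklore] -/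
theorem circuit_eval (C : Circuit ι) (x : ι → Bool) :
    C.eval x = wireOf x (vals C.gates x) C.output := by
  obtain ⟨gs, o, hwf, ho⟩ := C
  cases o <;> rfl

/-- A well-formed gate list with a valid output wire is a circuit (cf. `CktSize.toCircuit`).
[folklore] -/
def toCircuit (gs : List (Gate ι)) (o : ι ⊕ ℕ) (hwf : WF gs)
    (ho : ∀ m, o = .inr m → m < gs.length) : Circuit ι :=
  ⟨gs, o, fun j hj a m ha => hwf j _ (List.getElem?_eq_getElem hj) a m ha, ho⟩

end GateList


/-! ### Two-sided `2⁻ʳ`-separation (Jukna's `r`-hardness predicate) -/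

/-- `TwoSidedApprox r A B g`: the Boolean function `g` *`2⁻ʳ`-separates* the pair `(A, B)` in
the right or in the wrong direction — either `g` rejects at least a `2⁻ʳ` fraction of `A` and
accepts at least a `2⁻ʳ` fraction of `B`, or `g` accepts at least a `2⁻ʳ` fraction of `A` and
rejects at least a `2⁻ʳ` fraction of `B` (Jukna 2012, §9.9, definition of an `r`-hard pair, and
Exercise 9.7: "either `g` or its negation `¬g` rejects a `2⁻ʳ` fraction of inputs from `A` and
accepts a `2⁻ʳ` fraction of inputs from `B`"). Fractions are cleared of denominators:
`#A ≤ 2 ^ r * #{a ∈ A | g a = false}` etc. [cite: Jukna2012, §9.9] -/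
def TwoSidedApprox (r : ℕ) (A B : Finset (ι → Bool)) (g : (ι → Bool) → Bool) : Prop :=
  (#A ≤ 2 ^ r * #(A.filter fun a => g a = false) ∧ #B ≤ 2 ^ r * #(B.filter fun b => g b = true)) ∨
  (#A ≤ 2 ^ r * #(A.filter fun a => g a = true) ∧ #B ≤ 2 ^ r * #(B.filter fun b => g b = false))

namespace TwoSidedApprox

variable {r : ℕ} {A B : Finset (ι → Bool)} {g g' : (ι → Bool) → Bool}

/-- Monotonicity in `r`. [folklore] -/
theorem mono (h : TwoSidedApprox r A B g) {r' : ℕ} (hr : r ≤ r') : TwoSidedApprox r' A B g := by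
  have hp : 2 ^ r ≤ 2 ^ r' := Nat.pow_le_pow_right (by norm_num) hr
  rcases h with ⟨h1, h2⟩ | ⟨h1, h2⟩
  · exact Or.inl ⟨h1.trans (Nat.mul_le_mul_right _ hp), h2.trans (Nat.mul_le_mul_right _ hp)⟩
  · exact Or.inr ⟨h1.trans (Nat.mul_le_mul_right _ hp), h2.trans (Nat.mul_le_mul_right _ hp)⟩

/-- Extensionality in `g` on `A ∪ B`. [folklore] -/
theorem congr (h : TwoSidedApprox r A B g) (hA : ∀ a ∈ A, g a = g' a) (hB : ∀ b ∈ B, g b = g' b) :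
    TwoSidedApprox r A B g' := by
  have eA : ∀ c, (A.filter fun a => g a = c) = A.filter fun a => g' a = c := fun c =>
    Finset.filter_congr fun a ha => by rw [hA a ha]
  have eB : ∀ c, (B.filter fun b => g b = c) = B.filter fun b => g' b = c := fun c =>
    Finset.filter_congr fun b hb => by rw [hB b hb]
  unfold TwoSidedApprox at h ⊢
  rwa [← eA, ← eA, ← eB, ← eB]

/-- A function constant on `A` and (oppositely) on `B` separates with `r = 0`. [folklore] -/
theorem of_forall (hA : ∀ a ∈ A, g a = false) (hB : ∀ b ∈ B, g b = true) :
    TwoSidedApprox 0 A B g :=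
  Or.inl ⟨by rw [Finset.filter_true_of_mem hA]; simp, by rw [Finset.filter_true_of_mem hB]; simp⟩

/-- Halving both test sets costs one unit of `r`. [folklore] -/
theorem of_filter {p q : (ι → Bool) → Prop} [DecidablePred p] [DecidablePred q]
    (h : TwoSidedApprox r (A.filter p) (B.filter q) g) (hA : #A ≤ 2 * #(A.filter p))
    (hB : #B ≤ 2 * #(B.filter q)) : TwoSidedApprox (r + 1) A B g := by
  have key : ∀ (S : Finset (ι → Bool)) (s : (ι → Bool) → Prop) [DecidablePred s] (c : Bool),
      #S ≤ 2 * #(S.filter s) → #(S.filter s) ≤ 2 ^ r * #((S.filter s).filter fun a => g a = c) →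
      #S ≤ 2 ^ (r + 1) * #(S.filter fun a => g a = c) := by
    intro S s _ c h1 h2
    have h3 : #((S.filter s).filter fun a => g a = c) ≤ #(S.filter fun a => g a = c) :=
      Finset.card_le_card (Finset.filter_subset_filter _ (Finset.filter_subset _ _))
    calc #S ≤ 2 * #(S.filter s) := h1
      _ ≤ 2 * (2 ^ r * #(S.filter fun a => g a = c)) :=
        Nat.mul_le_mul_left 2 (h2.trans (Nat.mul_le_mul_left _ h3))
      _ = 2 ^ (r + 1) * #(S.filter fun a => g a = c) := by rw [pow_succ]; ring
  rcases h with ⟨h1, h2⟩ | ⟨h1, h2⟩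
  · exact Or.inl ⟨key A p false hA h1, key B q true hB h2⟩
  · exact Or.inr ⟨key A p true hA h1, key B q false hB h2⟩

/-- If `g = ε` on half of `A` and `g = ¬ε` on half of `B`, then `g` `2⁻¹`-separates. [folklore] -/
theorem of_half (ε : Bool) (hA : #A ≤ 2 * #(A.filter fun a => g a = ε))
    (hB : #B ≤ 2 * #(B.filter fun b => g b = !ε)) : TwoSidedApprox (r + 1) A B g := by
  have hp : ∀ n, 2 * n ≤ 2 ^ (r + 1) * n := fun n =>
    Nat.mul_le_mul_right n (by
      calc 2 = 2 ^ 1 := by norm_num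
        _ ≤ 2 ^ (r + 1) := Nat.pow_le_pow_right (by norm_num) (by omega))
  cases ε
  · exact Or.inl ⟨hA.trans (hp _), by simpa using hB.trans (hp _)⟩
  · exact Or.inr ⟨hA.trans (hp _), by simpa using hB.trans (hp _)⟩

end TwoSidedApprox

/-- Majority value: for every Boolean `g` and `ε`, half of `S` has `g = ε` or half has `g = ¬ε`.
[folklore] -/
theorem card_le_two_mul_card_filter_or {α : Type*} (S : Finset α) (g : α → Bool) (ε : Bool) :
    #S ≤ 2 * #(S.filter fun a => g a = ε) ∨ #S ≤ 2 * #(S.filter fun a => g a = !ε) := by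
  have h := Finset.card_filter_add_card_filter_not (s := S) (fun a => g a = ε)
  have h2 : (S.filter fun a => ¬ g a = ε) = S.filter fun a => g a = !ε :=
    Finset.filter_congr fun a _ => by cases g a <;> cases ε <;> simp
  rw [h2] at h
  omega

namespace GateList

/-- Validity of an output wire into a program with `L` gates. [folklore] -/
abbrev OutOK (L : ℕ) (o : ι ⊕ ℕ) : Prop := ∀ m, o = .inr m → m < L

/-- The NOT gate reading the wire `w`, as a gate of a straight-line program. [folklore] -/
def notGate (w : ι ⊕ ℕ) : Gate ι := ⟨1, fun v => !(v 0), fun _ => w⟩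

/-- Its gate function is `GateFn.not`. [folklore] -/
@[simp] theorem notGate_fn (w : ι ⊕ ℕ) : (notGate w).fn = GateFn.not := rfl

/-- A gate whose gate function is NOT is `notGate w` for its unique argument wire `w`.
[folklore] -/
theorem exists_eq_notGate_of_fn_eq {g : Gate ι} (h : g.fn = GateFn.not) : ∃ w, g = notGate w := by
  obtain ⟨k, op, args⟩ := g
  simp only [Gate.fn, GateFn.not, Sigma.mk.injEq] at h
  obtain ⟨rfl, hop⟩ := h
  simp only [heq_eq_eq] at hop
  subst hop
  refine ⟨args 0, ?_⟩
  simp only [notGate, Gate.mk.injEq, heq_eq_eq, true_and]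
  funext a
  rw [Subsingleton.elim a 0]

/-- The first NOT gate of a program containing one: everything before it is NOT-free.
[Jukna 2012, Ex. 9.7 (hint: "consider the first negation gate")] [folklore] -/
theorem exists_first_notGate :
    ∀ {gs : List (Gate ι)}, negs gs ≠ 0 →
      ∃ pre w post, gs = pre ++ notGate w :: post ∧ ∀ g ∈ pre, g.fn ≠ GateFn.not
  | [], h => by simp at h
  | g :: gs, h => by
    by_cases hg : g.fn = GateFn.not
    · obtain ⟨w, rfl⟩ := exists_eq_notGate_of_fn_eq hg
      exact ⟨[], w, gs, rfl, by simp⟩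
    · have h0 : negWeight g.fn = 0 := by simp [negWeight, hg]
      rw [negs_cons, h0, zero_add] at h
      obtain ⟨pre, w, post, rfl, hpre⟩ := exists_first_notGate h
      refine ⟨g :: pre, w, post, rfl, ?_⟩
      simpa [hg] using hpre

/-- The induction step of negation elimination: freeze the first NOT gate to the constant `¬ε`
on the inputs where its argument equals `ε` (Jukna 2012, Ex. 9.7, hint). [folklore] -/
theorem negationElimination_step (r : ℕ)
    (ih : ∀ (gs : List (Gate ι)) (o : ι ⊕ ℕ) (A B : Finset (ι → Bool)),
      WF gs → (∀ g ∈ gs, g.fn ∈ deMorganBasis01) → OutOK gs.length o → negs gs ≤ r →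
      (∀ a ∈ A, wireOf a (vals gs a) o = false) → (∀ b ∈ B, wireOf b (vals gs b) o = true) →
      ∃ (ms : List (Gate ι)) (o' : ι ⊕ ℕ), WF ms ∧ (∀ g ∈ ms, g.fn ∈ monotoneBasis01) ∧
        ms.length ≤ gs.length ∧ OutOK ms.length o' ∧
        TwoSidedApprox r A B (fun x => wireOf x (vals ms x) o'))
    (pre post : List (Gate ι)) (w o : ι ⊕ ℕ) (A B : Finset (ι → Bool)) (ε : Bool)
    (hwf : WF (pre ++ notGate w :: post))
    (hB : ∀ g ∈ pre ++ notGate w :: post, g.fn ∈ deMorganBasis01)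
    (ho : OutOK (pre ++ notGate w :: post).length o)
    (hnegs : negs (pre ++ notGate w :: post) ≤ r + 1)
    (hA : ∀ a ∈ A, wireOf a (vals (pre ++ notGate w :: post) a) o = false)
    (hBB : ∀ b ∈ B, wireOf b (vals (pre ++ notGate w :: post) b) o = true)
    (hAε : #A ≤ 2 * #(A.filter fun a => wireOf a (vals pre a) w = ε))
    (hBε : #B ≤ 2 * #(B.filter fun b => wireOf b (vals pre b) w = ε)) :
    ∃ (ms : List (Gate ι)) (o' : ι ⊕ ℕ), WF ms ∧ (∀ g ∈ ms, g.fn ∈ monotoneBasis01) ∧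
      ms.length ≤ (pre ++ notGate w :: post).length ∧ OutOK ms.length o' ∧
      TwoSidedApprox (r + 1) A B (fun x => wireOf x (vals ms x) o') := by
  -- the program with the NOT gate frozen to `¬ε`
  set gs' := pre ++ constGate ι (!ε) :: post with hgs'
  have hwf' : WF gs' := hwf.replace (gateOK_constGate _ _)
  have hB' : ∀ g ∈ gs', g.fn ∈ deMorganBasis01 := by
    intro g hg
    simp only [hgs', List.mem_append, List.mem_cons] at hg
    rcases hg with hg | rfl | hg
    · exact hB g (by simp [hg])
    · simpa using const_mem_deMorganBasis01 (!ε)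
    · exact hB g (by simp [hg])
  have hlen : gs'.length = (pre ++ notGate w :: post).length := by simp [hgs']
  have hnegs' : negs gs' ≤ r := by
    have h1 : negs (pre ++ notGate w :: post) = negs pre + (1 + negs post) := by simp
    have h2 : negs gs' = negs pre + (0 + negs post) := by simp [hgs']
    omega
  -- on inputs where the argument of the NOT gate is `ε`, nothing changes
  have hvals : ∀ x, wireOf x (vals pre x) w = ε →
      vals gs' x = vals (pre ++ notGate w :: post) x := by
    intro x hx
    refine (vals_replace_eq pre post _ _ x ?_).symm
    show (!(wireOf x (vals pre x) w)) = !ε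
    rw [hx]
  obtain ⟨ms, o', h1, h2, h3, h4, h5⟩ := ih gs' o (A.filter fun a => wireOf a (vals pre a) w = ε)
    (B.filter fun b => wireOf b (vals pre b) w = ε) hwf' hB' (hlen ▸ ho) hnegs'
    (fun a ha => by
      rw [Finset.mem_filter] at ha
      rw [hvals a ha.2]
      exact hA a ha.1)
    (fun b hb => by
      rw [Finset.mem_filter] at hb
      rw [hvals b hb.2]
      exact hBB b hb.1)
  exact ⟨ms, o', h1, h2, h3.trans hlen.le, h4, h5.of_filter hAε hBε⟩

/-- **Negation elimination, straight-line form** (Jukna 2012, Ex. 9.7). A program over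
`{∧₂, ∨₂, ¬, 0, 1}` with at most `r` NOT gates whose output wire rejects `A` and accepts `B`
yields a NOT-free program over `{∧₂, ∨₂, 0, 1}`, no longer than the original, with an output
wire that `2⁻ʳ`-separates `(A, B)` in the right or the wrong direction. [folklore] -/
theorem negationElimination_aux (r : ℕ) :
    ∀ (gs : List (Gate ι)) (o : ι ⊕ ℕ) (A B : Finset (ι → Bool)),
      WF gs → (∀ g ∈ gs, g.fn ∈ deMorganBasis01) → OutOK gs.length o → negs gs ≤ r →
      (∀ a ∈ A, wireOf a (vals gs a) o = false) → (∀ b ∈ B, wireOf b (vals gs b) o = true) →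
      ∃ (ms : List (Gate ι)) (o' : ι ⊕ ℕ), WF ms ∧ (∀ g ∈ ms, g.fn ∈ monotoneBasis01) ∧
        ms.length ≤ gs.length ∧ OutOK ms.length o' ∧
        TwoSidedApprox r A B (fun x => wireOf x (vals ms x) o') := by
  induction r with
  | zero =>
    intro gs o A B hwf hB ho hnegs hA hBB
    have hnegs0 : negs gs = 0 := Nat.le_zero.1 hnegs
    refine ⟨gs, o, hwf, fun g hg => ?_, le_rfl, ho, TwoSidedApprox.of_forall hA hBB⟩
    refine mem_monotoneBasis01_of_ne_not (hB g hg) fun hnot => ?_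
    obtain ⟨pre, post, rfl⟩ := List.append_of_mem hg
    have : negs (pre ++ g :: post) = negs pre + (1 + negs post) := by simp [hnot]
    omega
  | succ r ih =>
    intro gs o A B hwf hB ho hnegs hA hBB
    by_cases hle : negs gs ≤ r
    · obtain ⟨ms, o', h1, h2, h3, h4, h5⟩ := ih gs o A B hwf hB ho hle hA hBB
      exact ⟨ms, o', h1, h2, h3, h4, h5.mono (Nat.le_succ r)⟩
    obtain ⟨pre, w, post, rfl, hpre⟩ := exists_first_notGate (gs := gs) (by omega)
    -- the monotone function fed into the first NOT gate, and its majority value on `A`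
    have hw : OutOK pre.length w := fun m hm => hwf.gateOK_mid (0 : Fin 1) m hm
    obtain ⟨ε, hAε⟩ : ∃ ε : Bool, #A ≤ 2 * #(A.filter fun a => wireOf a (vals pre a) w = ε) := by
      rcases card_le_two_mul_card_filter_or A (fun a => wireOf a (vals pre a) w) true with h | h
      · exact ⟨true, h⟩
      · exact ⟨false, h⟩
    rcases card_le_two_mul_card_filter_or B (fun b => wireOf b (vals pre b) w) (!ε) with hBε | hBε
    · -- done: the prefix program itself separates
      refine ⟨pre, w, hwf.of_append_left, fun g hg => ?_, by simp, hw,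
        TwoSidedApprox.of_half ε hAε hBε⟩
      exact mem_monotoneBasis01_of_ne_not (hB g (by simp [hg])) (hpre g hg)
    · -- recurse: freeze the NOT gate
      rw [Bool.not_not] at hBε
      exact negationElimination_step r ih pre post w o A B ε hwf hB ho hnegs hA hBB hAε hBε

/-! ### Constant elimination: `{∧₂, ∨₂, 0, 1}`-programs to `{∧₂, ∨₂}`-programs -/

/-- Translation datum for one wire of a program with constants: the wire is either the
constant `b` (`inl b`) or carried by the wire `w` of the constant-free program `ns` (`inr w`).
[folklore] -/
def TransOK (ns : List (Gate ι)) (f : (ι → Bool) → Bool) : Bool ⊕ (ι ⊕ ℕ) → Prop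
  | .inl b => ∀ x, f x = b
  | .inr w => OutOK ns.length w ∧ ∀ x, f x = wireOf x (vals ns x) w

/-- Translation data survive appending gates to the constant-free program. [folklore] -/
theorem TransOK.append {ns sfx : List (Gate ι)} {f : (ι → Bool) → Bool} :
    ∀ {τ : Bool ⊕ (ι ⊕ ℕ)}, TransOK ns f τ → TransOK (ns ++ sfx) f τ
  | .inl _, h => h
  | .inr w, ⟨hw, hf⟩ =>
    ⟨fun m hm => (hw m hm).trans_le (by simp), fun x => by rw [hf, wireOf_vals_append _ _ _ _ hw]⟩

/-- Translation data are extensional in the translated function. [folklore] -/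
theorem TransOK.congr {ns : List (Gate ι)} {f f' : (ι → Bool) → Bool} (hff' : ∀ x, f x = f' x) :
    ∀ {τ : Bool ⊕ (ι ⊕ ℕ)}, TransOK ns f τ → TransOK ns f' τ
  | .inl _, h => fun x => (hff' x).symm.trans (h x)
  | .inr _, ⟨hw, hf⟩ => ⟨hw, fun x => (hff' x).symm.trans (hf x)⟩

/-- An input wire translates to itself. [folklore] -/
theorem transOK_inl (ns : List (Gate ι)) (i : ι) :
    TransOK ns (fun x => x i) (.inr (.inl i) : Bool ⊕ (ι ⊕ ℕ)) := by
  dsimp only [TransOK]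
  exact ⟨fun _ h => (by cases h), fun _ => rfl⟩

/-- The binary conjunction gate on two wires. [folklore] -/
def andGate (u v : ι ⊕ ℕ) : Gate ι := ⟨2, (GateFn.and 2).2, ![u, v]⟩

/-- The binary disjunction gate on two wires. [folklore] -/
def orGate (u v : ι ⊕ ℕ) : Gate ι := ⟨2, (GateFn.or 2).2, ![u, v]⟩

/-- `(andGate u v).fn = ∧₂`. [folklore] -/
@[simp] theorem andGate_fn (u v : ι ⊕ ℕ) : (andGate u v).fn = GateFn.and 2 := rfl

/-- `(orGate u v).fn = ∨₂`. [folklore] -/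
@[simp] theorem orGate_fn (u v : ι ⊕ ℕ) : (orGate u v).fn = GateFn.or 2 := rfl

/-- The conjunction gate computes `&&`. [folklore] -/
@[simp] theorem andGate_op (u v : ι ⊕ ℕ) (val : ι ⊕ ℕ → Bool) :
    (andGate u v).op (fun a => val ((andGate u v).args a)) = (val u && val v) := by
  simp [andGate, GateFn.and, Fin.forall_fin_two]

/-- The disjunction gate computes `||`. [folklore] -/
@[simp] theorem orGate_op (u v : ι ⊕ ℕ) (val : ι ⊕ ℕ → Bool) :
    (orGate u v).op (fun a => val ((orGate u v).args a)) = (val u || val v) := by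
  simp [orGate, GateFn.or, Fin.exists_fin_two]

/-- A gate with gate function `∧₂` is an `andGate`. [folklore] -/
theorem exists_eq_andGate_of_fn_eq {g : Gate ι} (h : g.fn = GateFn.and 2) :
    ∃ u v, g = andGate u v := by
  obtain ⟨k, op, args⟩ := g
  simp only [Gate.fn, GateFn.and, Sigma.mk.injEq] at h
  obtain ⟨rfl, hop⟩ := h
  simp only [heq_eq_eq] at hop
  subst hop
  refine ⟨args 0, args 1, ?_⟩
  simp only [andGate, GateFn.and, Gate.mk.injEq, heq_eq_eq, true_and]
  funext a
  fin_cases a <;> rfl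

/-- A gate with gate function `∨₂` is an `orGate`. [folklore] -/
theorem exists_eq_orGate_of_fn_eq {g : Gate ι} (h : g.fn = GateFn.or 2) :
    ∃ u v, g = orGate u v := by
  obtain ⟨k, op, args⟩ := g
  simp only [Gate.fn, GateFn.or, Sigma.mk.injEq] at h
  obtain ⟨rfl, hop⟩ := h
  simp only [heq_eq_eq] at hop
  subst hop
  refine ⟨args 0, args 1, ?_⟩
  simp only [orGate, GateFn.or, Gate.mk.injEq, heq_eq_eq, true_and]
  funext a
  fin_cases a <;> rfl

/-- A gate with a constant gate function is a `constGate`. [folklore] -/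
theorem exists_eq_constGate_of_fn_eq {g : Gate ι} {b : Bool} (h : g.fn = GateFn.const b) :
    g = constGate ι b := by
  obtain ⟨args, rfl⟩ := Gate.exists_eq_of_fn_eq h
  simp only [constGate, GateFn.const, Gate.mk.injEq, heq_eq_eq, true_and]
  funext a
  exact a.elim0

/-- Binary gates on two wires are valid where both wires are. [folklore] -/
theorem gateOK_andGate {L : ℕ} {u v : ι ⊕ ℕ} (hu : OutOK L u) (hv : OutOK L v) :
    GateOK L (andGate u v) := by
  refine Fin.forall_fin_two.2 ⟨fun m hm => hu m ?_, fun m hm => hv m ?_⟩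
  · simpa [andGate] using hm
  · simpa [andGate] using hm

/-- Binary gates on two wires are valid where both wires are. [folklore] -/
theorem gateOK_orGate {L : ℕ} {u v : ι ⊕ ℕ} (hu : OutOK L u) (hv : OutOK L v) :
    GateOK L (orGate u v) := by
  refine Fin.forall_fin_two.2 ⟨fun m hm => hu m ?_, fun m hm => hv m ?_⟩
  · simpa [orGate] using hm
  · simpa [orGate] using hm

/-- ∧₂ and ∨₂ are in the monotone basis. [folklore] -/
theorem and_mem_monotoneBasis : GateFn.and 2 ∈ monotoneBasis := Set.mem_insert _ _

/-- ∧₂ and ∨₂ are in the monotone basis. [folklore] -/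
theorem or_mem_monotoneBasis : GateFn.or 2 ∈ monotoneBasis :=
  Set.mem_insert_of_mem _ (Set.mem_singleton _)

/-- Combining two translated wires by `∧` (`isAnd = true`) or `∨` (`isAnd = false`): constants
are absorbed or dropped, otherwise one new monotone gate is appended. [folklore] -/
theorem TransOK.binop (isAnd : Bool) {ns : List (Gate ι)} (hwf : WF ns)
    (hB : ∀ g ∈ ns, g.fn ∈ monotoneBasis) {τ0 τ1 : Bool ⊕ (ι ⊕ ℕ)}
    {f0 f1 : (ι → Bool) → Bool} (h0 : TransOK ns f0 τ0) (h1 : TransOK ns f1 τ1) :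
    ∃ (sfx : List (Gate ι)) (τ : Bool ⊕ (ι ⊕ ℕ)), WF (ns ++ sfx) ∧
      (∀ g ∈ ns ++ sfx, g.fn ∈ monotoneBasis) ∧ sfx.length ≤ 1 ∧
      TransOK (ns ++ sfx) (fun x => if isAnd then (f0 x && f1 x) else (f0 x || f1 x)) τ := by
  rcases τ0 with b0 | w0
  · -- first argument constant
    by_cases hb : b0 = isAnd
    · -- neutral element: the result is the second argument
      refine ⟨[], τ1, by simpa using hwf, by simpa using hB, by simp, ?_⟩
      rw [List.append_nil]
      refine TransOK.congr (fun x => ?_) h1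
      have := h0 x
      rw [this, hb]
      cases isAnd <;> simp
    · -- absorbing element: the result is the constant
      refine ⟨[], .inl b0, by simpa using hwf, by simpa using hB, by simp, fun x => ?_⟩
      have := h0 x
      beta_reduce
      rw [this]
      cases isAnd <;> cases b0 <;> simp_all
  · rcases τ1 with b1 | w1
    · by_cases hb : b1 = isAnd
      · refine ⟨[], .inr w0, by simpa using hwf, by simpa using hB, by simp, ?_⟩
        rw [List.append_nil]
        refine TransOK.congr (fun x => ?_) h0
        have := h1 x
        rw [this, hb]
        cases isAnd <;> simp
      · refine ⟨[], .inl b1, by simpa using hwf, by simpa using hB, by simp, fun x => ?_⟩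
        have := h1 x
        beta_reduce
        rw [this]
        cases isAnd <;> cases b1 <;> simp_all
    · -- two genuine wires: one new gate
      obtain ⟨hw0, hf0⟩ := h0
      obtain ⟨hw1, hf1⟩ := h1
      cases isAnd
      · refine ⟨[orGate w0 w1], .inr (.inr ns.length),
          hwf.append_singleton (gateOK_orGate hw0 hw1),
          fun g hg => ?_, le_rfl, ⟨fun m hm => ?_, fun x => ?_⟩⟩
        · simp only [List.mem_append, List.mem_singleton] at hg
          rcases hg with hg | rfl
          · exact hB g hg
          · exact or_mem_monotoneBasis
        · cases hm; simp
        · simp only [Bool.false_eq_true, ↓reduceIte, wireOf_inr]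
          rw [show ns ++ [orGate w0 w1] = ns ++ orGate w0 w1 :: [] from rfl,
            getD_vals_append_cons, orGate_op, hf0, hf1]
      · refine ⟨[andGate w0 w1], .inr (.inr ns.length),
          hwf.append_singleton (gateOK_andGate hw0 hw1),
          fun g hg => ?_, le_rfl, ⟨fun m hm => ?_, fun x => ?_⟩⟩
        · simp only [List.mem_append, List.mem_singleton] at hg
          rcases hg with hg | rfl
          · exact hB g hg
          · exact and_mem_monotoneBasis
        · cases hm; simp
        · simp only [↓reduceIte, wireOf_inr]
          rw [show ns ++ [andGate w0 w1] = ns ++ andGate w0 w1 :: [] from rfl,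
            getD_vals_append_cons, andGate_op, hf0, hf1]

/-- Translating a wire of the original program: inputs to inputs, gates via `φ`. [folklore] -/
def trans (φ : ℕ → Bool ⊕ (ι ⊕ ℕ)) : ι ⊕ ℕ → Bool ⊕ (ι ⊕ ℕ)
  | .inl i => .inr (.inl i)
  | .inr m => φ m

/-- **Constant elimination.** Every program over `{∧₂, ∨₂, 0, 1}` has a companion program
over `{∧₂, ∨₂}`, no longer, such that every wire of the former is either constant or carried by
a wire of the latter (propagate constants: `0 ∧ h = 0`, `1 ∧ h = h`, `0 ∨ h = h`, `1 ∨ h = 1`).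
[folklore] -/
theorem constElim (ms : List (Gate ι)) (hwf : WF ms) (hB : ∀ g ∈ ms, g.fn ∈ monotoneBasis01) :
    ∃ (ns : List (Gate ι)) (φ : ℕ → Bool ⊕ (ι ⊕ ℕ)), WF ns ∧ (∀ g ∈ ns, g.fn ∈ monotoneBasis) ∧
      ns.length ≤ ms.length ∧
      ∀ m < ms.length, TransOK ns (fun x => (vals ms x).getD m false) (φ m) := by
  induction ms using List.reverseRecOn with
  | nil => exact ⟨[], fun _ => .inl false, WF.nil, by simp, le_rfl, fun m hm => absurd hm (by simp)⟩
  | append_singleton ms g ih =>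
    obtain ⟨ns, φ, hwf', hB', hlen, hφ⟩ :=
      ih hwf.of_append_left fun g hg => hB g (List.mem_append_left _ hg)
    have hgB : g.fn ∈ monotoneBasis01 := hB g (by simp)
    have hgOK : GateOK ms.length g := hwf.gateOK_mid (post := [])
    -- translation of the argument wires of `g`
    have hτ : ∀ u : ι ⊕ ℕ, OutOK ms.length u →
        TransOK ns (fun x => wireOf x (vals ms x) u) (trans φ u) := by
      rintro (i | m) hu
      · exact transOK_inl ns i
      · exact hφ m (hu m rfl)
    -- old wires keep their translation
    have hold : ∀ (sfx : List (Gate ι)) (m : ℕ), m < ms.length →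
        TransOK (ns ++ sfx) (fun x => (vals (ms ++ [g]) x).getD m false) (φ m) := by
      intro sfx m hm
      refine (TransOK.congr (fun x => ?_) (hφ m hm)).append
      exact (wireOf_vals_append ms [g] x (.inr m) (fun m' h => by cases h; exact hm)).symm
    -- the value of the new gate
    have hnew : ∀ x, (vals (ms ++ [g]) x).getD ms.length false =
        g.op (fun a => wireOf x (vals ms x) (g.args a)) := fun x =>
      getD_vals_append_cons ms g [] x
    simp only [monotoneBasis01, monotoneBasis, Set.mem_insert_iff, Set.mem_singleton_iff] at hgB
    rcases hgB with hc | hc | hc | hc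
    · -- constant `true`
      obtain rfl := exists_eq_constGate_of_fn_eq hc
      refine ⟨ns, fun m => if m = ms.length then .inl true else φ m, hwf', hB',
        hlen.trans (by simp), fun m hm => ?_⟩
      by_cases hmeq : m = ms.length
      · subst hmeq
        simp only [↓reduceIte]
        intro x
        beta_reduce
        rw [hnew]
        rfl
      · simp only [hmeq, ↓reduceIte]
        simpa using hold [] m (by simp at hm; omega)
    · -- constant `false`
      obtain rfl := exists_eq_constGate_of_fn_eq hc
      refine ⟨ns, fun m => if m = ms.length then .inl false else φ m, hwf', hB',
        hlen.trans (by simp), fun m hm => ?_⟩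
      by_cases hmeq : m = ms.length
      · subst hmeq
        simp only [↓reduceIte]
        intro x
        beta_reduce
        rw [hnew]
        rfl
      · simp only [hmeq, ↓reduceIte]
        simpa using hold [] m (by simp at hm; omega)
    · -- `∧₂`
      obtain ⟨u, v, rfl⟩ := exists_eq_andGate_of_fn_eq hc
      have hu : OutOK ms.length u := fun m hm => hgOK (0 : Fin 2) m hm
      have hv : OutOK ms.length v := fun m hm => hgOK (1 : Fin 2) m hm
      obtain ⟨sfx, τ, hwf'', hB'', hsfx, hτ'⟩ := TransOK.binop true hwf' hB' (hτ u hu) (hτ v hv)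
      refine ⟨ns ++ sfx, fun m => if m = ms.length then τ else φ m, hwf'', hB'',
        by simp; omega, fun m hm => ?_⟩
      by_cases hmeq : m = ms.length
      · subst hmeq
        simp only [↓reduceIte]
        refine TransOK.congr (fun x => ?_) hτ'
        rw [hnew, andGate_op]
        simp
      · simp only [hmeq, ↓reduceIte]
        exact hold sfx m (by simp at hm; omega)
    · -- `∨₂`
      obtain ⟨u, v, rfl⟩ := exists_eq_orGate_of_fn_eq hc
      have hu : OutOK ms.length u := fun m hm => hgOK (0 : Fin 2) m hm
      have hv : OutOK ms.length v := fun m hm => hgOK (1 : Fin 2) m hm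
      obtain ⟨sfx, τ, hwf'', hB'', hsfx, hτ'⟩ := TransOK.binop false hwf' hB' (hτ u hu) (hτ v hv)
      refine ⟨ns ++ sfx, fun m => if m = ms.length then τ else φ m, hwf'', hB'',
        by simp; omega, fun m hm => ?_⟩
      by_cases hmeq : m = ms.length
      · subst hmeq
        simp only [↓reduceIte]
        refine TransOK.congr (fun x => ?_) hτ'
        rw [hnew, orGate_op]
        simp
      · simp only [hmeq, ↓reduceIte]
        exact hold sfx m (by simp at hm; omega)

/-- Constant elimination for a single output wire: the function on an output wire of a program
over `{∧₂, ∨₂, 0, 1}` is constant, or computed by a circuit over `{∧₂, ∨₂}` with no more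
gates. [folklore] -/
theorem const_or_exists_monotone_circuit (ms : List (Gate ι)) (o : ι ⊕ ℕ) (hwf : WF ms)
    (hB : ∀ g ∈ ms, g.fn ∈ monotoneBasis01) (ho : OutOK ms.length o) :
    (∃ b, ∀ x, wireOf x (vals ms x) o = b) ∨
      ∃ C : Circuit ι, C.IsOver monotoneBasis ∧ C.size ≤ ms.length ∧
        ∀ x, C.eval x = wireOf x (vals ms x) o := by
  obtain ⟨ns, φ, hwf', hB', hlen, hφ⟩ := constElim ms hwf hB
  rcases o with i | m
  · exact Or.inr ⟨toCircuit ns (.inl i) hwf' (fun _ h => by cases h), hB', hlen, fun x => by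
      rw [circuit_eval]; rfl⟩
  · have h := hφ m (ho m rfl)
    revert h
    rcases φ m with b | w
    · exact fun h => Or.inl ⟨b, h⟩
    · exact fun ⟨hw, hf⟩ => Or.inr ⟨toCircuit ns w hwf' hw, hB', hlen, fun x => by
        rw [circuit_eval]; exact (hf x).symm⟩

/-! ### Monotone programs compute monotone functions -/

/-- Every wire of a program over `{∧₂, ∨₂}` carries a monotone function of the input
(Jukna 2012, §9.10). [folklore] -/
theorem monotone_wireOf_vals (ms : List (Gate ι)) (hwf : WF ms)
    (hB : ∀ g ∈ ms, g.fn ∈ monotoneBasis) (o : ι ⊕ ℕ) (ho : OutOK ms.length o) :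
    Monotone fun x => wireOf x (vals ms x) o := by
  induction ms using List.reverseRecOn generalizing o with
  | nil =>
    rcases o with i | m
    · exact fun x y hxy => hxy i
    · exact absurd (ho m rfl) (by simp)
  | append_singleton ms g ih =>
    have ih' := ih hwf.of_append_left (fun g hg => hB g (List.mem_append_left _ hg))
    have hgOK : GateOK ms.length g := hwf.gateOK_mid (post := [])
    -- wires below the new gate
    have hlow : ∀ u : ι ⊕ ℕ, OutOK ms.length u →
        Monotone fun x => wireOf x (vals (ms ++ [g]) x) u := fun u hu x y hxy => by
      simp only [wireOf_vals_append ms [g] _ u hu]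
      exact ih' u hu hxy
    rcases o with i | m
    · exact fun x y hxy => hxy i
    · by_cases hm : m = ms.length
      · subst hm
        have hgB := hB g (by simp)
        simp only [monotoneBasis, Set.mem_insert_iff, Set.mem_singleton_iff] at hgB
        intro x y hxy
        simp only [wireOf_inr]
        rw [show ms ++ [g] = ms ++ g :: [] from rfl, getD_vals_append_cons, getD_vals_append_cons]
        rcases hgB with hc | hc
        · obtain ⟨u, v, rfl⟩ := exists_eq_andGate_of_fn_eq hc
          rw [andGate_op, andGate_op]
          have hu := ih' u (fun m hm => hgOK (0 : Fin 2) m hm) hxy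
          have hv := ih' v (fun m hm => hgOK (1 : Fin 2) m hm) hxy
          simp only at hu hv
          revert hu hv
          cases wireOf x (vals ms x) u <;> cases wireOf x (vals ms x) v <;>
            cases wireOf y (vals ms y) u <;> cases wireOf y (vals ms y) v <;> simp
        · obtain ⟨u, v, rfl⟩ := exists_eq_orGate_of_fn_eq hc
          rw [orGate_op, orGate_op]
          have hu := ih' u (fun m hm => hgOK (0 : Fin 2) m hm) hxy
          have hv := ih' v (fun m hm => hgOK (1 : Fin 2) m hm) hxy
          simp only at hu hv
          revert hu hv
          cases wireOf x (vals ms x) u <;> cases wireOf x (vals ms x) v <;>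
            cases wireOf y (vals ms y) u <;> cases wireOf y (vals ms y) v <;> simp
      · have : m < ms.length := by have := ho m rfl; simp at this; omega
        exact hlow (.inr m) (fun m' h => by cases h; exact this)

end GateList

/-- A circuit over the monotone basis `{∧₂, ∨₂}` computes a monotone Boolean function
(Jukna 2012, §1.2 / §9.10). [folklore] -/
theorem Circuit.monotone_eval_of_isOver_monotoneBasis (C : Circuit ι)
    (hC : C.IsOver monotoneBasis) : Monotone C.eval := by
  have h := monotone_wireOf_vals C.gates (wf_gates C) hC C.output C.wf_output
  intro x y hxy
  rw [circuit_eval, circuit_eval]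
  exact h hxy

/-! ### Negation elimination (Jukna 2012, Exercise 9.7) -/

/-- **Negation elimination** (Jukna 2012, Exercise 9.7, p. 283; the tool behind `r`-hard pairs,
§9.9). Let `C` be a circuit over `{∧₂, ∨₂, ¬}` with at most `r` NOT gates, and let `A`, `B` be
finite sets of inputs rejected, resp. accepted, by `C`. Then there is a Boolean function `g`
which is either constant or computed by a circuit over the monotone basis `{∧₂, ∨₂}` with at
most `size C` gates (in particular `g` is monotone,
`Circuit.monotone_eval_of_isOver_monotoneBasis`), such that `g` or `¬g` rejects at least a
`2⁻ʳ` fraction of `A` and accepts at least a `2⁻ʳ` fraction of `B` (`TwoSidedApprox r A B g`).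
The disjunct "`g` constant" only reflects that the tree's `monotoneBasis` has no constant gates
(Jukna's monotone circuits may use the constants `0, 1`); it forces `A = ∅` or `B = ∅`.
[cite: Jukna2012, Ex. 9.7] -/
def negationElimination : Prop :=
  ∀ {ι : Type*} (C : Circuit ι), C.IsOver deMorganBasis → ∀ (r : ℕ), C.negationCount ≤ r →
    ∀ (A B : Finset (ι → Bool)), (∀ a ∈ A, C.eval a = false) → (∀ b ∈ B, C.eval b = true) →
      ∃ g : (ι → Bool) → Bool,
        ((∃ b, ∀ x, g x = b) ∨
          ∃ M : Circuit ι, M.IsOver monotoneBasis ∧ M.size ≤ C.size ∧ M.Computes g) ∧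
        TwoSidedApprox r A B g

/-- Proof of `negationElimination` (Jukna 2012, Ex. 9.7): induction on `r`, freezing the first
NOT gate to the majority value of its (monotone) argument on the surviving test inputs
(`GateList.negationElimination_aux`), followed by constant propagation
(`GateList.const_or_exists_monotone_circuit`). [cite: Jukna2012, Ex. 9.7] -/
theorem negationElimination_holds : negationElimination := by
  intro ι C hC r hr A B hA hB
  have hA' : ∀ a ∈ A, wireOf a (vals C.gates a) C.output = false := fun a ha => by
    rw [← circuit_eval]; exact hA a ha
  have hB' : ∀ b ∈ B, wireOf b (vals C.gates b) C.output = true := fun b hb => by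
    rw [← circuit_eval]; exact hB b hb
  obtain ⟨ms, o', hwf, hms, hlen, ho', h2⟩ := negationElimination_aux r C.gates C.output A B
    (wf_gates C) (fun g hg => deMorganBasis_subset_deMorganBasis01 (hC g hg)) C.wf_output
    (by rw [← circuit_negationCount]; exact hr) hA' hB'
  refine ⟨fun x => wireOf x (vals ms x) o', ?_, h2⟩
  rcases const_or_exists_monotone_circuit ms o' hwf hms ho' with h | ⟨M, hM, hsize, hev⟩
  · exact Or.inl h
  · exact Or.inr ⟨M, hM, hsize.trans hlen, hev⟩

/-- A constant function separates no pair of nonempty sets. [folklore] -/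
theorem TwoSidedApprox.not_of_forall_eq {ι : Type*} {r : ℕ} {A B : Finset (ι → Bool)}
    {g : (ι → Bool) → Bool} {b : Bool} (hb : ∀ x, g x = b) (hAne : A.Nonempty)
    (hBne : B.Nonempty) : ¬ TwoSidedApprox r A B g := by
  have hempty : ∀ (S : Finset (ι → Bool)) (c : Bool), c ≠ b → (S.filter fun x => g x = c) = ∅ :=
    fun S c hc => Finset.filter_false_of_mem fun x _ => by rw [hb x]; exact hc.symm
  have key : ∀ (S : Finset (ι → Bool)) (c : Bool), S.Nonempty →
      #S ≤ 2 ^ r * #(S.filter fun x => g x = c) → c = b := by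
    intro S c hS h
    by_contra hc
    rw [hempty S c hc, Finset.card_empty, mul_zero, Nat.le_zero, Finset.card_eq_zero] at h
    exact hS.ne_empty h
  rintro (⟨h1, h2⟩ | ⟨h1, h2⟩)
  · have e1 := key A false hAne h1
    have e2 := key B true hBne h2
    exact Bool.false_ne_true (e1.trans e2.symm)
  · have e1 := key A true hAne h1
    have e2 := key B false hBne h2
    exact Bool.false_ne_true (e2.trans e1.symm)

/-- Corollary in the form used for lower bounds (Jukna 2012, §9.9: "any `r`-hard pair `A, B`
requires a super-polynomial number of gates in any circuit that separates `A` from `B` and uses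
up to `r` NOT gates"), finite version: if NO circuit over `{∧₂, ∨₂}` with at most `t` gates
`2⁻ʳ`-separates the nonempty pair `(A, B)` in either direction, then every circuit over
`{∧₂, ∨₂, ¬}` with at most `r` NOT gates rejecting `A` and accepting `B` has more than `t`
gates. [cite: Jukna2012, §9.9] -/
theorem Circuit.lt_size_of_hardPair {ι : Type*} (C : Circuit ι)
    (hC : C.IsOver deMorganBasis) {r t : ℕ} (hr : C.negationCount ≤ r)
    (A B : Finset (ι → Bool)) (hAne : A.Nonempty) (hBne : B.Nonempty)
    (hA : ∀ a ∈ A, C.eval a = false) (hB : ∀ b ∈ B, C.eval b = true)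
    (hard : ∀ M : Circuit ι, M.IsOver monotoneBasis → M.size ≤ t →
      ¬ TwoSidedApprox r A B M.eval) :
    t < C.size := by
  refine lt_of_not_ge fun hle => ?_
  obtain ⟨g, hg, h2⟩ := negationElimination_holds C hC r hr A B hA hB
  rcases hg with ⟨b, hb⟩ | ⟨M, hM, hsize, hMg⟩
  · exact TwoSidedApprox.not_of_forall_eq hb hAne hBne h2
  · refine hard M hM (hsize.trans hle) (h2.congr (fun a _ => ?_) (fun b _ => ?_))
    · exact (hMg a).symm
    · exact (hMg b).symm

end Literature.Computability.Complexity
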